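import Mathlib
import Literature.NumberTheory.LFunctions.FeketePolynomial
import Literature.RingTheory.Valuation.AlgClosedResidue
import Literature.RingTheory.Valuation.RootReduction
import Summits.ValiantsHypothesis.ValiantsHypothesis.Theses.FeketeSOS
import Summits.ValiantsHypothesis.ValiantsHypothesis.Theorems.FeketeSOSDepthZeroShadow
import Summits.ValiantsHypothesis.ValiantsHypothesis.Theorems.FeketeSOSSublinearShadowTrivialShadow
import Summits.ValiantsHypothesis.ValiantsHypothesis.Theorems.FeketeSOSSublinearShadowThreeSquares
import Summits.ValiantsHypothesis.ValiantsHypothesis.Theorems.FeketeSOSSublinearShadowAlgebraicRep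
import Summits.ValiantsHypothesis.ValiantsHypothesis.Theorems.FeketeSOSSublinearShadowGramWindowShadow

/-!
# `FeketeSOS.SublinearShadow` (stmt-ValiantsHypothesis-14990), line `Sketch` — RESHAPE 6b: the crux is EQUIVALENT to its
# algebraic, nowhere-windowable few-squares Pareto-minimal core

`sublinearShadow_iff_coreFewNowhereWindow`: `SublinearShadow ↔` (for `p` large, every complex representation `Σ_{i<s} c_i g_i² = F_p`
with ALGEBRAIC coefficients, `deg g_i ≤ p²`, support-sum `S`, `S⁴ ≤ p³`, `3 ≤ s`, few squares `(s+1)^A·S < 2p`, Pareto-minimal support-sum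
among representations with `≤ s` squares, and whose Gram matrix `Q_{ab} = Σ_i c_i g_{i,a} g_{i,b}` is non-integral against EVERY WINDOW DATUM
of order `v + 1 ≤ (s+1)^A` — every field of definition `F ↪ ℂ`, valuation subring `O ∋ p` of `F`, ring map `ψ : O → K[T]/(T^{v+1})`
(`char K = p`), `w ∈ O`, `θ` with `ψ(w^θ) ≠ 0` has some `w^θ Q_{ab} ∉ O` — has a cyclic characteristic-`p` shadow with `≤ (s+1)^A` squares and
support `≤ (s+1)^A·S`).

`→` is restriction.  `←` (constants `A ↦ A + 3`, `p₁ ↦ max p₁ 257`) is the composition of line `Sketch`, reshape 6b, with every stub landed: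
Pareto-minimal representative (`Nat.find`), made algebraic by `stub_algebraicRep` (p141746; minimality keeps its support-sum), `≥ 3` squares
(`stub_threeSquares`), the trivial two-square shadow when `2p ≤ (s₀+1)^A S₀` (`stub_trivialShadow`), and otherwise either the core hypothesis
holds (apply the core) or its failure hands over a field of definition, a valuation subring and a window datum of order `v + 1 ≤ (s₀+1)^A`
seeing a `w^θ`-integral Gram matrix, where the GRAM-WINDOW TRANSFER `stub_gramWindowShadow` (p142060; built on `stub_qfModelField` p141154 and
`stub_windowTransfer` p141471) gives `d ≤ (2v+2)·2s₀² ≤ (s+1)^{A+3}`.  So the open residual of the line (`stub_coreFewNowhereWindow` of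
`Cruxes/SublinearShadow/Lines/Sketch.lean`) is crux-EQUIVALENT; what it isolates is unit-deep or over-ramified Gram data at every prime of the
number field of definition.
-/

namespace Summit.ValiantsHypothesis.ValiantsHypothesis.Theorems.SublinearShadowSketch

open Polynomial Finset IsLocalRing Matrix
open scoped BigOperators

-- `Summit.ValiantsHypothesis.ValiantsHypothesis.…` is the tree's mandated single-conjunct layout (Sub = Summit).
set_option linter.dupNamespace false

/-- `4 s² ≤ (s+1)^3`. -/
theorem wcr_four_mul_sq_le_cube (s : ℕ) : 4 * (s * s) ≤ (s + 1) ^ 3 := by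
  have : (s + 1) ^ 3 = s * s * s + 3 * (s * s) + 3 * s + 1 := by ring
  rw [this]; nlinarith [Nat.zero_le s, sq_nonneg (s - 1)]

/-- A representation over a field of definition `F ↪ ℂ` of a complex representation of `F_p` is a representation of `F_p`
over `F` (injectivity of `F[X] → ℂ[X]`). -/
theorem wcr_rep_descend (p : ℕ) [Fact p.Prime] {s : ℕ} {c : Fin s → ℂ} {g : Fin s → ℂ[X]}
    (hrep : (∑ i, C (c i) * g i ^ 2) = ∑ m ∈ Finset.range p, C ((legendreSym p m : ℤ) : ℂ) * X ^ m)
    {F : Type} [Field F] (ι : F →+* ℂ) (cF : Fin s → F) (gF : Fin s → F[X])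
    (hc : ∀ i, ι (cF i) = c i) (hg : ∀ i, (gF i).map ι = g i) :
    (∑ i, C (cF i) * gF i ^ 2) = ∑ m ∈ Finset.range p, C ((legendreSym p m : ℤ) : F) * X ^ m := by
  apply Polynomial.map_injective ι ι.injective
  rw [Polynomial.map_sum, Polynomial.map_sum]
  have lhs : ∀ i, (C (cF i) * gF i ^ 2).map ι = C (c i) * g i ^ 2 := fun i => by
    rw [Polynomial.map_mul, Polynomial.map_pow, map_C, hc, hg]
  have rhs : ∀ m : ℕ, (C ((legendreSym p m : ℤ) : F) * X ^ m).map ι = C ((legendreSym p m : ℤ) : ℂ) * X ^ m := fun m => by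
    rw [Polynomial.map_mul, Polynomial.map_pow, map_C, map_X, map_intCast]
  simp only [lhs, rhs]
  exact hrep

/-- **Core ⟹ crux** (the composition of line `Sketch`, reshape 6b, every stub landed; constants `A ↦ A + 3`,
`p₁ ↦ max p₁ 257`): Pareto-minimal representative by `Nat.find`, made algebraic by `stub_algebraicRep` (minimality
keeps its support-sum), `≥ 3` squares by `stub_threeSquares`, the trivial
two-square shadow (`stub_trivialShadow`) when `2p ≤ (s₀+1)^A·S₀`; otherwise either some window datum of order
`v + 1 ≤ (s₀+1)^A` over some field of definition sees an integral Gram matrix (`stub_gramWindowShadow`: `d ≤ (2v+2)·2s₀²`,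
support `≤ (2v+2)·2s₀²·S₀`) or the core hypothesis applies; monotonicity. -/
theorem sublinearShadow_of_coreFewNowhereWindow
    (hW : ∃ A p₁ : ℕ, ∀ (p : ℕ) [Fact p.Prime], p₁ ≤ p → ∀ (s : ℕ) (c : Fin s → ℂ) (g : Fin s → Polynomial ℂ),
            (∀ i, IsAlgebraic ℚ (c i)) → (∀ i n, IsAlgebraic ℚ ((g i).coeff n)) →
            (∀ i, (g i).natDegree ≤ p ^ 2) → (∑ i, (g i).support.card) ^ 4 ≤ p ^ 3 →
            (∑ i, Polynomial.C (c i) * g i ^ 2)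
              = ∑ m ∈ Finset.range p, Polynomial.C ((legendreSym p m : ℤ) : ℂ) * Polynomial.X ^ m →
            3 ≤ s → (s + 1) ^ A * (∑ i, (g i).support.card) < 2 * p →
            (∀ (s' : ℕ) (c' : Fin s' → ℂ) (g' : Fin s' → Polynomial ℂ), s' ≤ s →
              (∀ i, (g' i).natDegree ≤ p ^ 2) →
              (∑ i, Polynomial.C (c' i) * g' i ^ 2)
                = ∑ m ∈ Finset.range p, Polynomial.C ((legendreSym p m : ℤ) : ℂ) * Polynomial.X ^ m →
              (∑ i, (g i).support.card) ≤ ∑ i, (g' i).support.card) →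
            (∀ (F : Type) [Field F] (ι : F →+* ℂ) (cF : Fin s → F) (gF : Fin s → Polynomial F),
              (∀ i, ι (cF i) = c i) → (∀ i, (gF i).map ι = g i) →
              ∀ (O : ValuationSubring F), ((p : ℕ) : O) ∈ maximalIdeal O →
              ∀ (K : Type) [Field K] [CharP K p] (v : ℕ) (ψ : O →+* AdjoinRoot ((X : K[X]) ^ (v + 1))) (w : O) (θ : ℕ),
              v + 1 ≤ (s + 1) ^ A → ψ (w ^ θ) ≠ 0 →
              ∃ a b : ℕ, (w : F) ^ θ * (∑ i, cF i * (gF i).coeff a * (gF i).coeff b) ∉ O) →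
            ∃ (K : Type) (_ : Field K) (_ : CharP K p) (d : ℕ) (c' : Fin d → K) (g' : Fin d → Polynomial K),
              d ≤ (s + 1) ^ A ∧ (∀ j, (g' j).natDegree < p) ∧
              (∑ j, (g' j).support.card) ≤ (s + 1) ^ A * ∑ i, (g i).support.card ∧
              ((Polynomial.X : Polynomial K) ^ p - 1 ∣ (∑ j, Polynomial.C (c' j) * g' j ^ 2)
                - ∑ m ∈ Finset.range p, Polynomial.C ((legendreSym p m : ℤ) : K) * Polynomial.X ^ m)) :
    Summit.ValiantsHypothesis.ValiantsHypothesis.Theses.FeketeSOS.SublinearShadow := by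
  obtain ⟨A, p₁, H⟩ := hW
  unfold Summit.ValiantsHypothesis.ValiantsHypothesis.Theses.FeketeSOS.SublinearShadow
  refine ⟨A + 3, max p₁ 257, ?_⟩
  intro p _ hp s c g hdeg hS hrep
  classical
  have hprime : p.Prime := Fact.out
  have hp₁ : p₁ ≤ p := le_trans (le_max_left _ _) hp
  have hp257 : 257 ≤ p := le_trans (le_max_right _ _) hp
  have hp2 : p ≠ 2 := by omega
  -- Step 0: a Pareto-minimal representation below `(s, c, g)`
  set Srep : ℕ := ∑ i, (g i).support.card with hSrep
  have hex : ∃ n, ∃ (s' : ℕ) (c' : Fin s' → ℂ) (g' : Fin s' → Polynomial ℂ), s' ≤ s ∧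
      (∀ i, (g' i).natDegree ≤ p ^ 2) ∧
      (∑ i, Polynomial.C (c' i) * g' i ^ 2)
        = ∑ m ∈ Finset.range p, Polynomial.C ((legendreSym p m : ℤ) : ℂ) * Polynomial.X ^ m ∧
      (∑ i, (g' i).support.card) = n := ⟨Srep, s, c, g, le_rfl, hdeg, hrep, rfl⟩
  obtain ⟨s₀, c₀, g₀, hs₀, hdeg₀, hrep₀, hS₀⟩ := Nat.find_spec hex
  have hmin₀ : ∀ (s' : ℕ) (c' : Fin s' → ℂ) (g' : Fin s' → Polynomial ℂ), s' ≤ s →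
      (∀ i, (g' i).natDegree ≤ p ^ 2) →
      (∑ i, Polynomial.C (c' i) * g' i ^ 2)
        = ∑ m ∈ Finset.range p, Polynomial.C ((legendreSym p m : ℤ) : ℂ) * Polynomial.X ^ m →
      Nat.find hex ≤ ∑ i, (g' i).support.card :=
    fun s' c' g' hs' hdeg' hrep' => Nat.find_min' hex ⟨s', c', g', hs', hdeg', hrep', rfl⟩
  set S₀ : ℕ := ∑ i, (g₀ i).support.card with hS₀def
  have hS₀le : S₀ ≤ Srep := by rw [hS₀]; exact hmin₀ s c g le_rfl hdeg hrep
  have hS₀4 : S₀ ^ 4 ≤ p ^ 3 := le_trans (Nat.pow_le_pow_left hS₀le 4) hS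
  -- Step 0': an ALGEBRAIC representative with the same number of squares and no larger supports (`stub_algebraicRep`);
  -- by minimality its support-sum is again `S₀`
  obtain ⟨c₁, g₁, halgc, halgg, hsub, hrep₁⟩ := stub_algebraicRep p s₀ c₀ g₀ hrep₀
  have hdeg₁ : ∀ i, (g₁ i).natDegree ≤ p ^ 2 := fun i => by
    rw [Polynomial.natDegree_le_iff_coeff_eq_zero]
    intro m hm
    have hm₀ : m ∉ (g₀ i).support :=
      notMem_support_iff.mpr (coeff_eq_zero_of_natDegree_lt (lt_of_le_of_lt (hdeg₀ i) hm))
    exact notMem_support_iff.mp fun hm₁ => hm₀ (hsub i hm₁)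
  set S₁ : ℕ := ∑ i, (g₁ i).support.card with hS₁def
  have hS₁le : S₁ ≤ S₀ := Finset.sum_le_sum fun i _ => Finset.card_le_card (hsub i)
  have hS₁ge : S₀ ≤ S₁ := by rw [hS₀]; exact hmin₀ s₀ c₁ g₁ hs₀ hdeg₁ hrep₁
  have hS₁eq : S₁ = S₀ := le_antisymm hS₁le hS₁ge
  have hS₁4 : S₁ ^ 4 ≤ p ^ 3 := hS₁eq ▸ hS₀4
  have hmin : ∀ (s' : ℕ) (c' : Fin s' → ℂ) (g' : Fin s' → Polynomial ℂ), s' ≤ s₀ →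
      (∀ i, (g' i).natDegree ≤ p ^ 2) →
      (∑ i, Polynomial.C (c' i) * g' i ^ 2)
        = ∑ m ∈ Finset.range p, Polynomial.C ((legendreSym p m : ℤ) : ℂ) * Polynomial.X ^ m →
      S₁ ≤ ∑ i, (g' i).support.card := fun s' c' g' hs' hdeg' hrep' => by
    rw [hS₁eq, hS₀]; exact hmin₀ s' c' g' (hs'.trans hs₀) hdeg' hrep'
  -- Step 1: at least three squares; budget arithmetic
  have h3 : 3 ≤ s₀ := stub_threeSquares p hp257 s₀ c₀ g₀ hS₀4 hrep₀
  have hs1 : (s₀ + 1) ^ A ≤ (s + 1) ^ A := Nat.pow_le_pow_left (Nat.succ_le_succ hs₀) A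
  have hsA : (s + 1) ^ A ≤ (s + 1) ^ (A + 3) := Nat.pow_le_pow_right (Nat.succ_pos s) (Nat.le_add_right A 3)
  have hcube : (s₀ + 1) ^ 3 ≤ (s + 1) ^ 3 := Nat.pow_le_pow_left (Nat.succ_le_succ hs₀) 3
  have hsq : 4 * (s₀ * s₀) ≤ (s + 1) ^ 3 := (wcr_four_mul_sq_le_cube s₀).trans hcube
  have hpow3 : (s + 1) ^ (A + 3) = (s + 1) ^ A * (s + 1) ^ 3 := pow_add _ _ _
  have hsq' : 4 * (s₀ * s₀) ≤ (s + 1) ^ (A + 3) := by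
    rw [hpow3]
    exact le_mul_of_one_le_of_le (Nat.one_le_pow _ _ (Nat.succ_pos s)) hsq
  by_cases hmany : 2 * p ≤ (s₀ + 1) ^ A * S₀
  · -- Step 2a: many squares — the trivial two-square shadow over `ZMod p`
    obtain ⟨c', g', hdeg', hcard', hrep'⟩ := stub_trivialShadow p hp2
    refine ⟨ZMod p, inferInstance, inferInstance, 2, c', g', ?_, hdeg', ?_, ?_⟩
    · calc 2 ≤ 4 * (s₀ * s₀) := by nlinarith
        _ ≤ (s + 1) ^ (A + 3) := hsq'
    · calc ∑ j, (g' j).support.card ≤ 2 * p := hcard'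
        _ ≤ (s₀ + 1) ^ A * S₀ := hmany
        _ ≤ (s + 1) ^ (A + 3) * Srep := Nat.mul_le_mul (hs1.trans hsA) hS₀le
    · rw [hrep', sub_self]; exact dvd_zero _
  · push Not at hmany
    have hmany₁ : (s₀ + 1) ^ A * S₁ < 2 * p := by rw [hS₁eq]; exact hmany
    by_cases hdeep : ∀ (F : Type) [Field F] (ι : F →+* ℂ) (cF : Fin s₀ → F) (gF : Fin s₀ → Polynomial F),
        (∀ i, ι (cF i) = c₁ i) → (∀ i, (gF i).map ι = g₁ i) →
        ∀ (O : ValuationSubring F), ((p : ℕ) : O) ∈ maximalIdeal O →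
        ∀ (K : Type) [Field K] [CharP K p] (v : ℕ) (ψ : O →+* AdjoinRoot ((X : K[X]) ^ (v + 1))) (w : O) (θ : ℕ),
        v + 1 ≤ (s₀ + 1) ^ A → ψ (w ^ θ) ≠ 0 →
        ∃ a b : ℕ, (w : F) ^ θ * (∑ i, cF i * (gF i).coeff a * (gF i).coeff b) ∉ O
    · -- Step 2b: nowhere windowable — the residual, applied to the algebraic minimal representation
      obtain ⟨K, instF, instC, d, c', g', hd, hdeg', hcard, hdvd⟩ :=
        H p hp₁ s₀ c₁ g₁ halgc halgg hdeg₁ hS₁4 hrep₁ h3 hmany₁ hmin hdeep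
      refine ⟨K, instF, instC, d, c', g', ?_, hdeg', ?_, hdvd⟩
      · exact hd.trans (hs1.trans hsA)
      · calc ∑ j, (g' j).support.card ≤ (s₀ + 1) ^ A * S₁ := hcard
          _ ≤ (s + 1) ^ (A + 3) * Srep := Nat.mul_le_mul (hs1.trans hsA) (hS₁le.trans hS₀le)
    · -- Step 2c: some window datum over some field of definition sees an integral Gram matrix — the Gram-window shadow
      push Not at hdeep
      obtain ⟨F, instF, ι, cF, gF, hc, hg, O, hpO, K, instK, instC, v, ψ, w, θ, hv, hw, hgram⟩ := hdeep
      have hrepF := wcr_rep_descend p hrep₁ ι cF gF hc hg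
      have hsuppF : ∀ i, (gF i).support.card = (g₁ i).support.card := fun i => by
        rw [← hg i, Polynomial.support_map_of_injective _ ι.injective]
      obtain ⟨K', instF', instC', d, c', g', hd, hdeg', hcard, hdvd⟩ :=
        stub_gramWindowShadow p hp2 s₀ cF gF hrepF O hpO K v ψ w θ hw hgram
      have hbudget : (2 * v + 2) * (2 * (s₀ * s₀)) ≤ (s + 1) ^ (A + 3) := by
        calc (2 * v + 2) * (2 * (s₀ * s₀)) = (v + 1) * (4 * (s₀ * s₀)) := by ring
          _ ≤ (s₀ + 1) ^ A * (s + 1) ^ 3 := Nat.mul_le_mul hv hsq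
          _ ≤ (s + 1) ^ A * (s + 1) ^ 3 := Nat.mul_le_mul_right _ hs1
          _ = (s + 1) ^ (A + 3) := hpow3.symm
      refine ⟨K', instF', instC', d, c', g', hd.trans hbudget, hdeg', ?_, hdvd⟩
      calc ∑ j, (g' j).support.card ≤ (2 * v + 2) * (2 * (s₀ * s₀)) * ∑ i, (gF i).support.card := hcard
        _ = (2 * v + 2) * (2 * (s₀ * s₀)) * S₁ := by simp only [hsuppF, hS₁def]
        _ ≤ (s + 1) ^ (A + 3) * Srep := Nat.mul_le_mul hbudget (hS₁le.trans hS₀le)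

/-- **Crux ⟹ core** (restriction: the core has the crux's conclusion under more hypotheses). -/
theorem coreFewNowhereWindow_of_sublinearShadow
    (h : Summit.ValiantsHypothesis.ValiantsHypothesis.Theses.FeketeSOS.SublinearShadow) :
    ∃ A p₁ : ℕ, ∀ (p : ℕ) [Fact p.Prime], p₁ ≤ p → ∀ (s : ℕ) (c : Fin s → ℂ) (g : Fin s → Polynomial ℂ),
        (∀ i, IsAlgebraic ℚ (c i)) → (∀ i n, IsAlgebraic ℚ ((g i).coeff n)) →
        (∀ i, (g i).natDegree ≤ p ^ 2) → (∑ i, (g i).support.card) ^ 4 ≤ p ^ 3 →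
        (∑ i, Polynomial.C (c i) * g i ^ 2)
          = ∑ m ∈ Finset.range p, Polynomial.C ((legendreSym p m : ℤ) : ℂ) * Polynomial.X ^ m →
        3 ≤ s → (s + 1) ^ A * (∑ i, (g i).support.card) < 2 * p →
        (∀ (s' : ℕ) (c' : Fin s' → ℂ) (g' : Fin s' → Polynomial ℂ), s' ≤ s →
          (∀ i, (g' i).natDegree ≤ p ^ 2) →
          (∑ i, Polynomial.C (c' i) * g' i ^ 2)
            = ∑ m ∈ Finset.range p, Polynomial.C ((legendreSym p m : ℤ) : ℂ) * Polynomial.X ^ m →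
          (∑ i, (g i).support.card) ≤ ∑ i, (g' i).support.card) →
        (∀ (F : Type) [Field F] (ι : F →+* ℂ) (cF : Fin s → F) (gF : Fin s → Polynomial F),
          (∀ i, ι (cF i) = c i) → (∀ i, (gF i).map ι = g i) →
          ∀ (O : ValuationSubring F), ((p : ℕ) : O) ∈ maximalIdeal O →
          ∀ (K : Type) [Field K] [CharP K p] (v : ℕ) (ψ : O →+* AdjoinRoot ((X : K[X]) ^ (v + 1))) (w : O) (θ : ℕ),
          v + 1 ≤ (s + 1) ^ A → ψ (w ^ θ) ≠ 0 →
          ∃ a b : ℕ, (w : F) ^ θ * (∑ i, cF i * (gF i).coeff a * (gF i).coeff b) ∉ O) →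
        ∃ (K : Type) (_ : Field K) (_ : CharP K p) (d : ℕ) (c' : Fin d → K) (g' : Fin d → Polynomial K),
          d ≤ (s + 1) ^ A ∧ (∀ j, (g' j).natDegree < p) ∧
          (∑ j, (g' j).support.card) ≤ (s + 1) ^ A * ∑ i, (g i).support.card ∧
          ((Polynomial.X : Polynomial K) ^ p - 1 ∣ (∑ j, Polynomial.C (c' j) * g' j ^ 2)
            - ∑ m ∈ Finset.range p, Polynomial.C ((legendreSym p m : ℤ) : K) * Polynomial.X ^ m) := by
  obtain ⟨A, p₁, H⟩ := h
  refine ⟨A, p₁, ?_⟩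
  intro p _ hp s c g _ _ hdeg hS hrep _ _ _ _
  exact H p hp s c g hdeg hS hrep

/-- **RESHAPE 6b: `SublinearShadow` ⟺ its algebraic, nowhere-windowable few-squares Pareto-minimal core.** -/
theorem sublinearShadow_iff_coreFewNowhereWindow :
    Summit.ValiantsHypothesis.ValiantsHypothesis.Theses.FeketeSOS.SublinearShadow ↔
    (∃ A p₁ : ℕ, ∀ (p : ℕ) [Fact p.Prime], p₁ ≤ p → ∀ (s : ℕ) (c : Fin s → ℂ) (g : Fin s → Polynomial ℂ),
        (∀ i, IsAlgebraic ℚ (c i)) → (∀ i n, IsAlgebraic ℚ ((g i).coeff n)) →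
        (∀ i, (g i).natDegree ≤ p ^ 2) → (∑ i, (g i).support.card) ^ 4 ≤ p ^ 3 →
        (∑ i, Polynomial.C (c i) * g i ^ 2)
          = ∑ m ∈ Finset.range p, Polynomial.C ((legendreSym p m : ℤ) : ℂ) * Polynomial.X ^ m →
        3 ≤ s → (s + 1) ^ A * (∑ i, (g i).support.card) < 2 * p →
        (∀ (s' : ℕ) (c' : Fin s' → ℂ) (g' : Fin s' → Polynomial ℂ), s' ≤ s →
          (∀ i, (g' i).natDegree ≤ p ^ 2) →
          (∑ i, Polynomial.C (c' i) * g' i ^ 2)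
            = ∑ m ∈ Finset.range p, Polynomial.C ((legendreSym p m : ℤ) : ℂ) * Polynomial.X ^ m →
          (∑ i, (g i).support.card) ≤ ∑ i, (g' i).support.card) →
        (∀ (F : Type) [Field F] (ι : F →+* ℂ) (cF : Fin s → F) (gF : Fin s → Polynomial F),
          (∀ i, ι (cF i) = c i) → (∀ i, (gF i).map ι = g i) →
          ∀ (O : ValuationSubring F), ((p : ℕ) : O) ∈ maximalIdeal O →
          ∀ (K : Type) [Field K] [CharP K p] (v : ℕ) (ψ : O →+* AdjoinRoot ((X : K[X]) ^ (v + 1))) (w : O) (θ : ℕ),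
          v + 1 ≤ (s + 1) ^ A → ψ (w ^ θ) ≠ 0 →
          ∃ a b : ℕ, (w : F) ^ θ * (∑ i, cF i * (gF i).coeff a * (gF i).coeff b) ∉ O) →
        ∃ (K : Type) (_ : Field K) (_ : CharP K p) (d : ℕ) (c' : Fin d → K) (g' : Fin d → Polynomial K),
          d ≤ (s + 1) ^ A ∧ (∀ j, (g' j).natDegree < p) ∧
          (∑ j, (g' j).support.card) ≤ (s + 1) ^ A * ∑ i, (g i).support.card ∧
          ((Polynomial.X : Polynomial K) ^ p - 1 ∣ (∑ j, Polynomial.C (c' j) * g' j ^ 2)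
            - ∑ m ∈ Finset.range p, Polynomial.C ((legendreSym p m : ℤ) : K) * Polynomial.X ^ m)) :=
  ⟨coreFewNowhereWindow_of_sublinearShadow, sublinearShadow_of_coreFewNowhereWindow⟩

end Summit.ValiantsHypothesis.ValiantsHypothesis.Theorems.SublinearShadowSketch
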